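import Literature.NumberTheory.Automorphic.UnitaryThreeAnisotropicStabilizerResidueData     -- ★ FILE 2e-α (this seat): `v_div_sub_div_eq`; brings ★ 2c, Bounds, `LocalConjDatum`
import HarnessLib

/-!
# Prop. 16, row `[N∕2] < m ≤ N`: the `A`-condition is a CLASS FUNCTION of `u = q∕s (mod 𝔭^m)` — the bracket in `(u, N(s))`-form and its `ϖ^m`-perturbation bound
# (Flicker 1998, Prop. 16 p. 96 — LAYER B′ step 2, FILE 3 (iii-b), part 2a)

Topic `NumberTheory/Automorphic`; namespace `Literature.NumberTheory.Automorphic.UnitaryGroup`.  THEOREMS ONLY (no `def`, no instance, no notation, no named fact, no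
`sorry`; count-neutral).  Cell `pub/hodgecm-mathlib`, F0∕P3a road «D-N7-inert», line «N7nsCount» ((F11-c) `stub_irredGValueNeg`); LAYER B′ design pen + cutting hand
A-p13 (g30).  HONEST LABEL: HC_CM is proved only modulo the printed citations until rung 0 closes; this is the reduction step of the LAST open row of Prop. 16
(`[N∕2] < m ≤ N ∧ N < M ⇒ (q+1)q^{N+2m}`): it shows the fixed-point condition descends to `𝒪⧸𝔭^m` along the first coordinate of ★ FILE 2e-γ's bijection; the residue count
`#{ū : …} = q^N` is part 2b.

THE MATHEMATICS.  Condition 2 of ★ B-p14 (ii-a)∕(ii-b) for the coset of `h ↔ (b,q,r,s)` reads `|bracket| ≤ |ϖ^{2m+1}|`,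
`bracket = (A_t − 1) − 4ϖ(A_t − s_t)·σq·q − 4ϖ(q_t·σq·s − Δ_t·(σq_t·q·σs))`, `Δ_t = A_t∕σs_t`.  With `u := q∕s`, `n := σs·s = N(s)`:
**`bracket = B(u, n) := (A_t − 1) − 4ϖ(A_t − s_t)·(σu·u)·n − 4ϖ·n·(q_t·σu − Δ_t·σq_t·u)`** (`bracket_eq_of_div`, exact algebra), and (U2) gives `n·(1 + 4ϖ·N(u)) = 1`.  PERTURBATION
(`v_bracket_sub_bracket_le`): for `|u − u′| ≤ |ϖ^m|`, `|n − n′| ≤ |ϖ^{m+1}|`, integral `u, u′, n, n′`, `|q_t| = |ϖ|^N`, `|A_t − s_t| ≤ |ϖ|^{N+1}`, `|Δ_t| = 1` and `m ≤ N`: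
`|B(u,n) − B(u′,n′)| ≤ |ϖ|^{N+m+1} ≤ |ϖ^{2m+1}|`; and `|N(s) − N(s′)| ≤ |ϖ^{m+1}|` for unit vectors over `ϖ^m`-close `u, u′` (`v_norm_sub_norm_le`).  Hence
(`bracket_le_iff_of_close`) **condition 2 takes the same value on all cosets with the same `q∕s mod 𝔭^m`** — Flicker p. 96: «the condition is on `c̄ (mod π^{m})` only».

## References
* [Flicker1998UnitaryFL] Y. Z. Flicker, *Elementary proof of the fundamental lemma for a unitary group*, Canad. J. Math. 50 (1998), Prop. 16 p. 96.
-/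

set_option autoImplicit false

noncomputable section

open scoped WithZero

namespace Literature.NumberTheory.Automorphic

namespace UnitaryGroup

open Literature.NumberTheory.Automorphic.HermitianLattice

variable {K : Type*} [Field K] [Valued K ℤᵐ⁰] {ϖ : K} (σ : K →+* K)

/-! ## §1 The bracket in `(u, n)`-form -/

omit [Valued K ℤᵐ⁰] in
/-- **`bracket(s, q) = B(q∕s, σs·s)`** (exact algebra, `s ≠ 0`). [cite: Flicker1998UnitaryFL, Prop. 16 p. 96] -/
theorem bracket_eq_of_div (ϖ : K) {At st qt Δt s q : K} (hs : s ≠ 0) :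
    (At - 1) - 4 * ϖ * (At - st) * (σ q * q) - 4 * ϖ * (qt * σ q * s - Δt * (σ qt * q * σ s)) =
      (At - 1) - 4 * ϖ * (At - st) * (σ (q / s) * (q / s)) * (σ s * s) - 4 * ϖ * (σ s * s) * (qt * σ (q / s) - Δt * σ qt * (q / s)) := by
  have hσs : σ s ≠ 0 := (map_ne_zero σ).2 hs
  rw [map_div₀]
  field_simp

/-! ## §2 Perturbation bounds -/

/-- **`|N(u) − N(u′)| ≤ |u − u′|`** for integral `u, u′` (`N(u) − N(u′) = σu(u − u′) + u′σ(u − u′)`). [cite: Flicker1998UnitaryFL, Prop. 16 p. 96] -/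
theorem v_norm_sub_norm_le_v_sub (hd : LocalConjDatum σ ϖ) {u u' : K} (hu : Valued.v u ≤ 1) (hu' : Valued.v u' ≤ 1) :
    Valued.v (σ u * u - σ u' * u') ≤ Valued.v (u - u') := by
  have e : σ u * u - σ u' * u' = σ u * (u - u') + u' * σ (u - u') := by rw [map_sub]; ring
  rw [e]
  refine (Valuation.map_add _ _ _).trans (max_le ?_ ?_)
  · rw [map_mul, hd.vσ]; exact (mul_le_mul' hu le_rfl).trans_eq (one_mul _)
  · rw [map_mul, hd.vσ]; exact (mul_le_mul' hu' le_rfl).trans_eq (one_mul _)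

/-- **`|N(s) − N(s′)| ≤ |ϖ|·|u − u′|`** for unit vectors `(s, us)`, `(s′, u′s′)`: `n(1 + 4ϖN(u)) = 1 = n′(1 + 4ϖN(u′))` gives `n − n′ = 4ϖ·n·n′·(N(u′) − N(u))`.
[cite: Flicker1998UnitaryFL, Prop. 16 p. 96] -/
theorem v_norm_sub_norm_le (hd : LocalConjDatum σ ϖ) {u u' n n' : K} (hu : Valued.v u ≤ 1) (hu' : Valued.v u' ≤ 1) (hn : Valued.v n ≤ 1) (hn' : Valued.v n' ≤ 1)
    (hU : n * (1 + 4 * ϖ * (σ u * u)) = 1) (hU' : n' * (1 + 4 * ϖ * (σ u' * u')) = 1) :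
    Valued.v (n - n') ≤ Valued.v ϖ * Valued.v (u - u') := by
  have e : n - n' = 4 * ϖ * (n * n') * (σ u' * u' - σ u * u) := by linear_combination n' * hU - n * hU'
  have h4 : Valued.v (4 : K) = 1 := by rw [show (4 : K) = 2 * 2 by norm_num, map_mul, hd.v2, one_mul]
  rw [e, map_mul, map_mul, map_mul, h4, one_mul, map_mul]
  calc Valued.v ϖ * (Valued.v n * Valued.v n') * Valued.v (σ u' * u' - σ u * u)
      ≤ Valued.v ϖ * (1 * 1) * Valued.v (u' - u) := mul_le_mul' (mul_le_mul' le_rfl (mul_le_mul' hn hn')) (v_norm_sub_norm_le_v_sub σ hd hu' hu)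
    _ = Valued.v ϖ * Valued.v (u - u') := by rw [mul_one, mul_one, ← neg_sub u u', Valuation.map_neg]

/-- **PERTURBATION OF THE BRACKET**: `|B(u,n) − B(u′,n′)| ≤ |ϖ^{2m+1}|` when `|u − u′| ≤ |ϖ^m|`, `|n − n′| ≤ |ϖ|·|ϖ^m|`, everything integral, `|q_t| = |ϖ|^N`,
`|A_t − s_t| ≤ |ϖ|^{N+1}`, `|Δ_t| ≤ 1`, and `m ≤ N`. [cite: Flicker1998UnitaryFL, Prop. 16 p. 96] -/
theorem v_bracket_sub_bracket_le (hd : LocalConjDatum σ ϖ) {At st qt Δt u u' n n' : K} (hu : Valued.v u ≤ 1) (hu' : Valued.v u' ≤ 1)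
    (hn : Valued.v n ≤ 1) (hn' : Valued.v n' ≤ 1) (hΔt : Valued.v Δt ≤ 1) (N m : ℕ) (hmN : m ≤ N)
    (hqt : Valued.v qt = WithZero.exp (-(N : ℤ))) (hAst : Valued.v (At - st) ≤ WithZero.exp (-((N : ℤ) + 1)))
    (hclose : Valued.v (u - u') ≤ Valued.v (ϖ ^ m)) (hnn : Valued.v (n - n') ≤ Valued.v ϖ * Valued.v (ϖ ^ m)) :
    Valued.v (((At - 1) - 4 * ϖ * (At - st) * (σ u * u) * n - 4 * ϖ * n * (qt * σ u - Δt * σ qt * u)) -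
        ((At - 1) - 4 * ϖ * (At - st) * (σ u' * u') * n' - 4 * ϖ * n' * (qt * σ u' - Δt * σ qt * u'))) ≤ Valued.v (ϖ ^ (2 * m + 1)) := by
  have hvσ := hd.vσ
  have h4 : Valued.v (4 : K) = 1 := by rw [show (4 : K) = 2 * 2 by norm_num, map_mul, hd.v2, one_mul]
  have hϖ1 : Valued.v ϖ ≤ 1 := by rw [hd.vϖ, ← WithZero.exp_zero]; exact WithZero.exp_le_exp.2 (by norm_num)
  -- target bound `|ϖ|^{N+1}·|ϖ^m| ≤ |ϖ^{2m+1}|`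
  have hB : WithZero.exp (-((N : ℤ) + 1)) * Valued.v (ϖ ^ m) ≤ Valued.v (ϖ ^ (2 * m + 1)) := by
    rw [hd.v_pow, hd.v_pow, ← WithZero.exp_add, WithZero.exp_le_exp]; push_cast; omega
  have hqt1 : Valued.v (4 * ϖ) * Valued.v qt = WithZero.exp (-((N : ℤ) + 1)) := by
    rw [map_mul, h4, one_mul, hd.vϖ, hqt, ← WithZero.exp_add]; congr 1; ring
  -- decomposition of the difference
  have e : ((At - 1) - 4 * ϖ * (At - st) * (σ u * u) * n - 4 * ϖ * n * (qt * σ u - Δt * σ qt * u)) -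
      ((At - 1) - 4 * ϖ * (At - st) * (σ u' * u') * n' - 4 * ϖ * n' * (qt * σ u' - Δt * σ qt * u')) =
      -(4 * ϖ * (At - st) * ((σ u * u - σ u' * u') * n + σ u' * u' * (n - n'))) +
        -(4 * ϖ * (qt * ((n - n') * σ u + n' * σ (u - u')) - Δt * σ qt * ((n - n') * u + n' * (u - u')))) := by
    rw [map_sub]; ring
  rw [e]
  refine (Valuation.map_add _ _ _).trans (max_le ?_ ?_)
  · -- `|4ϖ(A_t − s_t)|·max(|N(u)−N(u′)|, |n − n′|) ≤ |ϖ|^{N+2}·… ≤ |ϖ|^{N+1}|ϖ^m|`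
    rw [Valuation.map_neg, map_mul, map_mul, map_mul, h4, one_mul]
    refine le_trans ?_ hB
    have hin : Valued.v ((σ u * u - σ u' * u') * n + σ u' * u' * (n - n')) ≤ Valued.v (ϖ ^ m) := by
      refine (Valuation.map_add _ _ _).trans (max_le ?_ ?_)
      · rw [map_mul]
        calc Valued.v (σ u * u - σ u' * u') * Valued.v n ≤ Valued.v (ϖ ^ m) * 1 :=
              mul_le_mul' ((v_norm_sub_norm_le_v_sub σ hd hu hu').trans hclose) hn
          _ = _ := mul_one _
      · rw [map_mul, map_mul, hvσ]
        calc Valued.v u' * Valued.v u' * Valued.v (n - n') ≤ 1 * 1 * (Valued.v ϖ * Valued.v (ϖ ^ m)) :=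
              mul_le_mul' (mul_le_mul' hu' hu') hnn
          _ ≤ 1 * 1 * (1 * Valued.v (ϖ ^ m)) := mul_le_mul' le_rfl (mul_le_mul' hϖ1 le_rfl)
          _ = _ := by rw [one_mul, one_mul, one_mul]
    calc Valued.v ϖ * Valued.v (At - st) * Valued.v ((σ u * u - σ u' * u') * n + σ u' * u' * (n - n'))
        ≤ 1 * WithZero.exp (-((N : ℤ) + 1)) * Valued.v (ϖ ^ m) := mul_le_mul' (mul_le_mul' hϖ1 hAst) hin
      _ = _ := by rw [one_mul]
  · -- `|4ϖ|·(|q_t|·|ϖ^m|)`-type bound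
    rw [Valuation.map_neg]
    refine le_trans ?_ hB
    have hX : Valued.v (qt * ((n - n') * σ u + n' * σ (u - u')) - Δt * σ qt * ((n - n') * u + n' * (u - u'))) ≤ Valued.v qt * Valued.v (ϖ ^ m) := by
      refine (Valuation.map_sub _ _ _).trans (max_le ?_ ?_)
      · rw [map_mul]
        refine mul_le_mul' le_rfl ((Valuation.map_add _ _ _).trans (max_le ?_ ?_))
        · rw [map_mul, hvσ]
          calc Valued.v (n - n') * Valued.v u ≤ (Valued.v ϖ * Valued.v (ϖ ^ m)) * 1 := mul_le_mul' hnn hu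
            _ ≤ (1 * Valued.v (ϖ ^ m)) * 1 := mul_le_mul' (mul_le_mul' hϖ1 le_rfl) le_rfl
            _ = _ := by rw [one_mul, mul_one]
        · rw [map_mul, hvσ]
          calc Valued.v n' * Valued.v (u - u') ≤ 1 * Valued.v (ϖ ^ m) := mul_le_mul' hn' hclose
            _ = _ := one_mul _
      · rw [map_mul, map_mul, hvσ]
        calc Valued.v Δt * Valued.v qt * Valued.v ((n - n') * u + n' * (u - u')) ≤ 1 * Valued.v qt * Valued.v (ϖ ^ m) := by
              refine mul_le_mul' (mul_le_mul' hΔt le_rfl) ((Valuation.map_add _ _ _).trans (max_le ?_ ?_))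
              · rw [map_mul]
                calc Valued.v (n - n') * Valued.v u ≤ (Valued.v ϖ * Valued.v (ϖ ^ m)) * 1 := mul_le_mul' hnn hu
                  _ ≤ (1 * Valued.v (ϖ ^ m)) * 1 := mul_le_mul' (mul_le_mul' hϖ1 le_rfl) le_rfl
                  _ = _ := by rw [one_mul, mul_one]
              · rw [map_mul]
                calc Valued.v n' * Valued.v (u - u') ≤ 1 * Valued.v (ϖ ^ m) := mul_le_mul' hn' hclose
                  _ = _ := one_mul _
          _ = Valued.v qt * Valued.v (ϖ ^ m) := by rw [one_mul]
    calc Valued.v (4 * ϖ * (qt * ((n - n') * σ u + n' * σ (u - u')) - Δt * σ qt * ((n - n') * u + n' * (u - u'))))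
        = Valued.v (4 * ϖ) * Valued.v (qt * ((n - n') * σ u + n' * σ (u - u')) - Δt * σ qt * ((n - n') * u + n' * (u - u'))) :=
          Valuation.map_mul _ _ _
      _ ≤ Valued.v (4 * ϖ) * (Valued.v qt * Valued.v (ϖ ^ m)) := mul_le_mul' le_rfl hX
      _ = WithZero.exp (-((N : ℤ) + 1)) * Valued.v (ϖ ^ m) := by rw [← mul_assoc, hqt1]

/-! ## §3 Condition 2 is constant on the fibres of `q∕s mod 𝔭^m` -/

/-- Ultrametric transfer: `|x − y| ≤ B ⇒ (|x| ≤ B ↔ |y| ≤ B)`. [folklore] -/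
private theorem v_le_iff_of_sub_le_bracket {x y : K} {B : ℤᵐ⁰} (h : Valued.v (x - y) ≤ B) : Valued.v x ≤ B ↔ Valued.v y ≤ B := by
  constructor
  · intro hx
    have e : y = x - (x - y) := by ring
    rw [e]; exact (Valuation.map_sub _ _ _).trans (max_le hx h)
  · intro hy
    have e : x = y + (x - y) := by ring
    rw [e]; exact (Valuation.map_add _ _ _).trans (max_le hy h)

/-- **CONDITION 2 DEPENDS ON THE COSET ONLY THROUGH `q∕s mod 𝔭^m`** (`m ≤ N`): for unit vectors `(s,q)`, `(s′,q′)` (`N(s) + 4ϖN(q) = 1`) with `|s q′ − q s′| ≤ |ϖ^m|`,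
`|bracket(s,q)| ≤ |ϖ^{2m+1}| ⟺ |bracket(s′,q′)| ≤ |ϖ^{2m+1}|` (`t`-data: `|q_t| = |ϖ|^N`, `|A_t − s_t| ≤ |ϖ|^{N+1}`, `|Δ_t| ≤ 1`). [cite: Flicker1998UnitaryFL, Prop. 16 p. 96] -/
theorem bracket_le_iff_of_close (hd : LocalConjDatum σ ϖ) {At st qt Δt s q s' q' : K} (hs : Valued.v s = 1) (hq : Valued.v q ≤ 1) (hs' : Valued.v s' = 1)
    (hq' : Valued.v q' ≤ 1) (hU2 : σ s * s + 4 * ϖ * (σ q * q) = 1) (hU2' : σ s' * s' + 4 * ϖ * (σ q' * q') = 1) (hΔt : Valued.v Δt ≤ 1)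
    (N m : ℕ) (hmN : m ≤ N) (hqt : Valued.v qt = WithZero.exp (-(N : ℤ))) (hAst : Valued.v (At - st) ≤ WithZero.exp (-((N : ℤ) + 1)))
    (hclose : Valued.v (s * q' - q * s') ≤ Valued.v (ϖ ^ m)) :
    Valued.v ((At - 1) - 4 * ϖ * (At - st) * (σ q * q) - 4 * ϖ * (qt * σ q * s - Δt * (σ qt * q * σ s))) ≤ Valued.v (ϖ ^ (2 * m + 1)) ↔
      Valued.v ((At - 1) - 4 * ϖ * (At - st) * (σ q' * q') - 4 * ϖ * (qt * σ q' * s' - Δt * (σ qt * q' * σ s'))) ≤ Valued.v (ϖ ^ (2 * m + 1)) := by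
  have hs0 : s ≠ 0 := fun h0 => by rw [h0, map_zero] at hs; exact zero_ne_one hs
  have hs0' : s' ≠ 0 := fun h0 => by rw [h0, map_zero] at hs'; exact zero_ne_one hs'
  rw [bracket_eq_of_div σ ϖ hs0, bracket_eq_of_div σ ϖ hs0']
  apply v_le_iff_of_sub_le_bracket
  -- hypotheses of the perturbation lemma
  have hu : Valued.v (q / s) ≤ 1 := by rw [map_div₀, hs, div_one]; exact hq
  have hu' : Valued.v (q' / s') ≤ 1 := by rw [map_div₀, hs', div_one]; exact hq'
  have hn : Valued.v (σ s * s) ≤ 1 := by rw [map_mul, hd.vσ, hs, mul_one]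
  have hn' : Valued.v (σ s' * s') ≤ 1 := by rw [map_mul, hd.vσ, hs', mul_one]
  have hU : σ s * s * (1 + 4 * ϖ * (σ (q / s) * (q / s))) = 1 := by
    have hσs : σ s ≠ 0 := (map_ne_zero σ).2 hs0
    rw [map_div₀]; field_simp; linear_combination hU2
  have hU' : σ s' * s' * (1 + 4 * ϖ * (σ (q' / s') * (q' / s'))) = 1 := by
    have hσs : σ s' ≠ 0 := (map_ne_zero σ).2 hs0'
    rw [map_div₀]; field_simp; linear_combination hU2'
  have hcl : Valued.v (q / s - q' / s') ≤ Valued.v (ϖ ^ m) := by rw [v_div_sub_div_eq hs hs']; exact hclose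
  exact v_bracket_sub_bracket_le σ hd hu hu' hn hn' hΔt N m hmN hqt hAst hcl (v_norm_sub_norm_le σ hd hu hu' hn hn' hU hU' |>.trans (mul_le_mul' le_rfl hcl))

end UnitaryGroup

end Literature.NumberTheory.Automorphic

end
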